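import Literature.Analysis.FluidPDE.TaoAveragedCascadeReduction
import HarnessLib

/-!
# Tao 2016, §3.2–§3.9 as named facts, and `localCascade_isComplexAverage` from them

T. Tao, *Finite time blowup for an averaged three-dimensional Navier–Stokes equation*,
J. Amer. Math. Soc. **29** (2016), 601–674 = arXiv:1402.0290v3 (held as `paper:arxiv-1402.0290`),
§3.2–§3.9, pp. 15–20. The named fact
`Literature.Analysis.FluidPDE.Tao2016.localCascade_isComplexAverage`
(`TaoAveragedComplexAverage.lean`: for `ε₀` below an absolute threshold every local cascade
operator is a complex average of the Euler bilinear operator `B`) is decomposed here along the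
printed steps, over the objects of `TaoAveragedCascadeReduction.lean`, into six named facts
(ranked by depth; each a `Prop`-valued definition, not asserted):

1. `singleScale_isComplexAverageNoDil` — **§3.5–§3.9** (the core): for normalised profiles,
   `C₀` is a dilation-free complex average of `B_{η,ρ,0}`, i.e. (3.9) — Plancherel and the
   symbol extraction (3.13), rotation averaging over `SO(3)³` (3.16), the implicit function
   theorem and rotations about fixed axes (3.20), rotation angles (3.23), Fourier inversion on
   `(ℝ/2πℤ)³` and the non-degeneracy (3.24);
2. `cascade_of_singleScale` — **§3.4**: (3.9) implies that the complexified basic cascade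
   operator `C` (3.6) is a complex average of `B_{η,ρ}` (rescaled symbols
   `m̃ = Σₙ m((1+ε₀)^{-n}·)`, cross terms vanishing by the supports of `m`, `η`, `ρ`);
3. `betaForm_isComplexAverage` — **§3.3**: `B_η` is a complex average of `B` (the
   imaginary-order multipliers `D^{it}`, Fourier inversion of `(x,y) ↦ η(1,eˣ,eʸ)`, Fubini);
4. `complexAverage_trans` — **§3.2 ¶3**: transitivity of complex averaging towards `B`
   (Fubini, Leibniz bounds for composed symbols, "rotation and dilation operators normalise
   `𝓜₀ ⊗ ℂ`");
5. `basicCascade_of_normalised` — **§3.2 ¶2**: decomposition of the real annular profiles of a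
   basic cascade operator into complex pieces with Fourier supports in balls `B(ξⱼ⁰, ε₀³)` and
   the normalisation (3.7) of the centres by per-slot rotations and dilations (the closure of
   complex averages of `B` under finite linear combinations, §3.2 ¶1, is *proved* in
   `TaoAveragedCascadeAssembly.lean`);
6. `betaRhoForm_isComplexAverage` — **§3.3, last paragraph**: `B_{η,ρ}(u,v) = B_η(ρ(D)u, v)`
   "is clearly a complex average of `B_η`" (`ρ ∈ 𝓜₀ ⊗ ℂ`, one-point datum).

`normalised_isComplexAverage_of_steps` assembles 1–4 and 6 (with the minimum of the
thresholds): for normalised profiles `C` is a complex average of `B_{η,ρ}` (1, 2), `B_{η,ρ}` of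
`B_η` (6), `B_η` of `B` (3), hence `C` of `B` by transitivity (4, twice). The finite-sum closure,
fact 5 and the §3.1 theorems then give Theorem 3.2 (`TaoAveragedCascadeAssembly.lean`).

## References

* T. Tao, J. Amer. Math. Soc. 29 (2016), 601–674, arXiv:1402.0290v3, §3.2–§3.9 pp. 15–20,
  (3.6)–(3.24). Key `Tao2016AveragedNS`.
-/

noncomputable section

open MeasureTheory Set Filter
open scoped SchwartzMap

namespace Literature.Analysis.FluidPDE.Tao2016

/-- Local notation for physical / frequency space `ℝ³`. -/
local notation "ℝ³" => EuclideanSpace ℝ (Fin 3)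
/-- Local notation for the complexified range `ℂ³`. -/
local notation "ℂ³" => EuclideanSpace ℂ (Fin 3)

/-- **Normalised profiles** (§3.2): three complex Schwartz fields `ψⱼ` with `ψ̂ⱼ` supported in
the ball `B(ξⱼ⁰, ε₀³)` about the normalised base frequencies (3.7). [cite: Tao2016AveragedNS, §3.2 pp. 15–16] -/
def NormalisedProfiles (ε₀ : ℝ) (ψ : Fin 3 → 𝓢(ℝ³, ℂ³)) : Prop :=
  ∀ j, HasBallFourierSupport (xi0 j) (ε₀ ^ 3) (ψ j)

/-! ### The six named facts -/

/-- **Tao 2016, §3.5–§3.9 (fifth to ninth steps): the single-scale, dilation-free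
representation (3.9).** For `ε₀ > 0` below an absolute threshold and normalised profiles `ψⱼ`
(`ψ̂ⱼ ⊆ B(ξⱼ⁰, ε₀³)`, (3.7)), `C₀` (3.8) is a complex average of `B_{η,ρ,0}` without dilation
operators: `⟨C₀(u,v), w⟩ = ∫_Ω ⟨B_{η,ρ,0}(m_{1,ω}(D) Rot_{R_{1,ω}} u, m_{2,ω}(D) Rot_{R_{2,ω}} v), m_{3,ω}(D) Rot_{R_{3,ω}} w⟩ dμ(ω)`.
Printed proof: extraction of the symbol by Plancherel, reducing (3.9) to the pointwise tensor
identity (3.13) (§3.5); restriction to rotations almost fixing `ξⱼ⁰`, the manifold `Σ`, Haar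
measure on `SO(3)³` and a Fourier expansion, reducing to (3.16) (§3.6); the implicit function
theorem and rotations `R^θ_ξ` about fixed axes, reducing to (3.20) on `(ℝ/2πℤ)³ × Γ` (§3.7);
rotation angles `Yⱼ = R^{αⱼ}_{ηⱼ} n`, reducing to (3.23) (§3.8); Fourier inversion on the
3-torus under the non-degeneracy condition (3.24), which is verified for the normalisation
(3.7): `c_σ = -(1/8i)(-σ₁ + σ₂/√2 + σ₁σ₂σ₃/√2) + O(ε₀) ≠ 0` (§3.9). A `Prop`-valued definition,
not asserted. [cite: Tao2016AveragedNS, §3.5–3.9 (3.9)–(3.24)] -/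
def singleScale_isComplexAverageNoDil : Prop :=
  ∃ ε₁ : ℝ, 0 < ε₁ ∧ ∀ ε₀ : ℝ, 0 < ε₀ → ε₀ ≤ ε₁ →
    ∀ ψ : Fin 3 → 𝓢(ℝ³, ℂ³), NormalisedProfiles ε₀ ψ →
      IsComplexAverageNoDilOf (singleScaleForm (ψ 0) (ψ 1) (ψ 2)) (betaRhoZeroForm ε₀)

/-- **Tao 2016, §3.4 (fourth step: localising to a single frequency scale).** For `ε₀ > 0`
below an absolute threshold and normalised profiles: *"Suppose for now that we can show that
`C₀` is a complex average of `B_{η,ρ,0}` (without the use of dilation operators), thus (3.9) …"*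
— then, smoothly localising the `m_{j,ω}` to `B(ξⱼ⁰, O(ε₀³))`, setting
`m_{i,ω,n}(ξ) = m_{i,ω}((1+ε₀)^{-n}ξ)`, `m̃_{i,ω} = Σₙ m_{i,ω,n}` (again order-`0` multipliers
obeying (3.5)), the cross terms `(n₁,n₂,n₃)` not all equal vanish "if `ε₀` is small enough
(thanks to the support properties of `m_{i,ω,n}`, `η` and `ρ`)", and summing the scaling laws for
`B_{η,ρ,n}`, `Cₙ` gives *"`⟨C(u,v), w⟩ = (1/(-πi)) ∫_Ω ⟨B_{η,ρ}(m̃_{1,ω}(D) Rot u, m̃_{2,ω}(D) Rot v), m̃_{3,ω}(D) Rot w⟩ dμ(ω)`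
… thus demonstrating that `C` is a complex average of `B_{η,ρ}` as desired"*. A `Prop`-valued
definition, not asserted. [cite: Tao2016AveragedNS, §3.4 pp. 16–17] -/
def cascade_of_singleScale : Prop :=
  ∃ ε₁ : ℝ, 0 < ε₁ ∧ ∀ ε₀ : ℝ, 0 < ε₀ → ε₀ ≤ ε₁ →
    ∀ ψ : Fin 3 → 𝓢(ℝ³, ℂ³), NormalisedProfiles ε₀ ψ →
      IsComplexAverageNoDilOf (singleScaleForm (ψ 0) (ψ 1) (ψ 2)) (betaRhoZeroForm ε₀) →
        IsComplexAverageOf (cplxBasicCascadeForm ε₀ (ψ 0) (ψ 1) (ψ 2)) (betaRhoForm ε₀)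

/-- **Tao 2016, §3.3 (third step: forcing frequency comparability).** For `ε₀ > 0` below an
absolute threshold, the frequency-comparable Euler form `B_η` (taken here by its symbol,
`betaForm`) is a complex average of `B`: with `φ` rapidly decreasing given by Fourier inversion of
the smooth compactly supported `(x,y) ↦ η(1, eˣ, eʸ)`,
`⟨B_η(u,v), w⟩ = ∫∫ ⟨B(D^{-it₂-it₃}u, D^{it₂}v), D^{it₃}w⟩ φ(t₂,t₃) dt₂dt₃`, the imaginary-order
multipliers `\widehat{D^{it}u}(ξ) = |ξ|^{it} û(ξ)` being of order `0` with `‖D^{it}‖_k` growing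
polynomially in `t`, "then `B_η` is a complex average of `B`", and by (1.3) and Fubini it has the
symbol `η(|ξ₁|,|ξ₂|,|ξ₃|) Λ`. A `Prop`-valued definition, not asserted. [cite: Tao2016AveragedNS, §3.3 p. 16] -/
def betaForm_isComplexAverage : Prop :=
  ∃ ε₁ : ℝ, 0 < ε₁ ∧ ∀ ε₀ : ℝ, 0 < ε₀ → ε₀ ≤ ε₁ →
    IsComplexAverageOf (betaForm ε₀) eulerForm

/-- **Tao 2016, §3.3, last paragraph: `B_{η,ρ}` is a complex average of `B_η`.** "Let `ρ(D)` be
the associated Fourier multiplier; this is easily checked to be a Fourier multiplier of order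
`0`. By Definition 3.4, the bilinear operator `B_{η,ρ}` defined by `B_{η,ρ}(u,v) := B_η(ρ(D)u, v)`
is clearly a complex average of `B_η`" (the one-point datum with `m₁ = ρ`, `m₂ = m₃ = 1`; for
the symbol forms `betaRhoForm`, `betaForm` this also records `\widehat{ρ(D)u} = ρ û`). For `ε₀ > 0`
below an absolute threshold (so that the dyadic balls supporting `ρ` are disjoint). A
`Prop`-valued definition, not asserted. [cite: Tao2016AveragedNS, §3.3 p. 16] -/
def betaRhoForm_isComplexAverage : Prop :=
  ∃ ε₁ : ℝ, 0 < ε₁ ∧ ∀ ε₀ : ℝ, 0 < ε₀ → ε₀ ≤ ε₁ →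
    IsComplexAverageOf (betaRhoForm ε₀) (betaForm ε₀)

/-- **Tao 2016, §3.2 ¶3: transitivity of complex averaging (towards `B`).** "From this
[the Leibniz bounds `‖m(D)m'(D)‖_k ≤ C_k Σ ‖m(D)‖_{k₁} ‖m'(D)‖_{k₂}`], Fubini's theorem, and
Hölder's inequality, together with the observation that rotation and dilation operators
normalise `𝓜₀ ⊗ ℂ`, we have the following transitivity property: if `C₁` is a complex average
of `C₂`, and `C₂` is a complex average of `C₃`, then `C₁` is a complex average of `C₃`."
Recorded for `C₃ = B` (the only case used; for the tree's `IsComplexAverageOf`, which carries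
no boundedness hypothesis, the absolute convergence needed for Fubini is that of the composite
average of `B`, Tao p. 7 and (3.5)). A `Prop`-valued definition, not asserted. [cite: Tao2016AveragedNS, §3.2 p. 16] -/
def complexAverage_trans : Prop :=
  ∀ C₁ C₂ : L2C → L2C → L2C → ℂ,
    IsComplexAverageOf C₁ C₂ → IsComplexAverageOf C₂ eulerForm → IsComplexAverageOf C₁ eulerForm

/-- **Tao 2016, §3.2 ¶2: reduction of a basic cascade operator to normalised complexified ones.**
For `ε₀ > 0` below an absolute threshold: if every complexified basic cascade operator (3.6)
with normalised profiles (`ψ̂ⱼ ⊆ B(ξⱼ⁰, ε₀³)`, (3.7)) is a complex average of `B`, then so is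
every basic local cascade operator (3.1) with dyadic parameter `ε₀` (real Schwartz profiles with
Fourier support in the annulus `{1-2ε₀ ≤ |ξ| ≤ 1+2ε₀}`). Printed ingredients: "by decomposing
the `ψⱼ` … into finitely many (complex-valued) pieces, we may replace the basic local cascade
operator with the complexified basic local cascade operator (3.6)" with `ψ̂ⱼ` supported on balls
`B(ξⱼ⁰, ε₀³)`, `|ξⱼ⁰|` comparable to `1` (a partition of unity on the annulus in frequency
space, the multilinearity of (3.1) and its absolute convergence, p. 14, and the closure of
complex averages of `B` under finite sums — the latter proved, `isComplexAverageOf_sum_eulerForm`);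
and "due to the presence of rotations and dilations in the definition of a complex average, we
have the freedom to rotate and dilate each of the `ξⱼ⁰` as we please. We shall select the
normalisation (3.7)" (conjugating a complex average of `B` by fixed per-slot rotations and
dilations gives a complex average of `B`; pieces are taken of radius `ε₀³/2`, as the
normalising dilations have ratio at most `√2/(1-2ε₀) < 2`). A `Prop`-valued definition, not
asserted. [cite: Tao2016AveragedNS, §3.2 pp. 15–16] -/
def basicCascade_of_normalised : Prop :=
  ∃ ε₁ : ℝ, 0 < ε₁ ∧ ∀ ε₀ : ℝ, 0 < ε₀ → ε₀ ≤ ε₁ →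
    (∀ ψ : Fin 3 → 𝓢(ℝ³, ℂ³), NormalisedProfiles ε₀ ψ →
        IsComplexAverageOf (cplxBasicCascadeForm ε₀ (ψ 0) (ψ 1) (ψ 2)) eulerForm) →
      ∀ ψ₁ ψ₂ ψ₃ : 𝓢(ℝ³, ℝ³), HasAnnularFourierSupport ε₀ ψ₁ → HasAnnularFourierSupport ε₀ ψ₂ →
        HasAnnularFourierSupport ε₀ ψ₃ →
          IsComplexAverageOf (basicCascadeForm ε₀ ψ₁ ψ₂ ψ₃) eulerForm

/-! ### The normalised complexified operators are complex averages of `B` -/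

/-- **From steps 1–4 and 6: for `ε₀` below the minimum of the thresholds, every complexified
basic cascade operator with normalised profiles is a complex average of `B`** (§3.3–§3.9 read
backwards: `C₀` is a dilation-free complex average of `B_{η,ρ,0}`, hence `C` one of `B_{η,ρ}`,
`B_{η,ρ}` of `B_η`, `B_η` of `B`, and transitivity twice). [cite: Tao2016AveragedNS, §3.2–3.9] -/
theorem normalised_isComplexAverage_of_steps (h₁ : singleScale_isComplexAverageNoDil)
    (h₂ : cascade_of_singleScale) (h₃ : betaForm_isComplexAverage)
    (h₄ : complexAverage_trans) (h₆ : betaRhoForm_isComplexAverage) :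
    ∃ ε₁ : ℝ, 0 < ε₁ ∧ ∀ ε₀ : ℝ, 0 < ε₀ → ε₀ ≤ ε₁ →
      ∀ ψ : Fin 3 → 𝓢(ℝ³, ℂ³), NormalisedProfiles ε₀ ψ →
        IsComplexAverageOf (cplxBasicCascadeForm ε₀ (ψ 0) (ψ 1) (ψ 2)) eulerForm := by
  obtain ⟨e₁, he₁, h₁⟩ := h₁
  obtain ⟨e₂, he₂, h₂⟩ := h₂
  obtain ⟨e₃, he₃, h₃⟩ := h₃
  obtain ⟨e₆, he₆, h₆⟩ := h₆
  refine ⟨min e₁ (min e₂ (min e₃ e₆)), lt_min he₁ (lt_min he₂ (lt_min he₃ he₆)),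
    fun ε₀ hε₀ hle φ hφ => ?_⟩
  have hle₁ : ε₀ ≤ e₁ := hle.trans (min_le_left _ _)
  have hle₂ : ε₀ ≤ e₂ := hle.trans ((min_le_right _ _).trans (min_le_left _ _))
  have hle₃ : ε₀ ≤ e₃ :=
    hle.trans ((min_le_right _ _).trans ((min_le_right _ _).trans (min_le_left _ _)))
  have hle₆ : ε₀ ≤ e₆ :=
    hle.trans ((min_le_right _ _).trans ((min_le_right _ _).trans (min_le_right _ _)))
  have hC : IsComplexAverageOf (cplxBasicCascadeForm ε₀ (φ 0) (φ 1) (φ 2)) (betaRhoForm ε₀) :=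
    h₂ ε₀ hε₀ hle₂ φ hφ (h₁ ε₀ hε₀ hle₁ φ hφ)
  have hBrho : IsComplexAverageOf (betaRhoForm ε₀) eulerForm :=
    h₄ _ _ (h₆ ε₀ hε₀ hle₆) (h₃ ε₀ hε₀ hle₃)
  exact h₄ _ _ hC hBrho

end Literature.Analysis.FluidPDE.Tao2016
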